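import Mathlib
import Summits.CriticalPhenomena.CardyFormulaZ2.Theorems.CardySelfRefinementDefs
import Summits.CriticalPhenomena.CardyFormulaZ2.Theorems.CardySelfRefinementGradientComparabilityStubCornerHWBBypassWalk
import HarnessLib

/-!
# Crux `GradientComparability` (stmt-CriticalPhenomena-10269), line `monotone-product-coordinates` —
# stub `stub_cornerHardWayBoxes` (HWB), brick (ii-c), part 2: the interior bypass of a bundle

Route `CardySelfRefinement`; vocabulary from `CardySelfRefinementDefs` (`ax tb opn cfg edgeOf dirVec`);
the rerouting lemma, the strip toolkit and the read-out facts from `…StubCornerHWBBypassWalk`.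

## Mathematics

Fix `k = 2, 3` and a bundle `(t, d)` (the `k` collinear axial sub-edges of the coarse edge from `kt`
in direction `d`), with corners `U = kt`, `U' = kt + k e_d`, vertex set `D` and strip
`N = [kt_d - 1, kt_d + k + 1] × [kt_{d'} - 1, kt_{d'} + 1]` (`d'` the other index).  The GOOD part
`C = N ∖ {U, U'}` of the strip is connected by INTERIOR (non-axial) strip edges inside any
box-closed vertex set `R` with the two-neighbour property (`strip_connected`): leave the coarse row
`kt_{d'}` across (a good vertex on it sits on a non-coarse column), find a non-coarse strip column met
by `R`, and run along the (non-coarse) rows `kt_{d'} ± 1` and across on that column.  Every lattice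
neighbour of a corner is good (`bundle_corner_step`, `k ≥ 2`), the endpoints of a sub-edge of the
bundle are in `D` (`inD_of_subedge`).  Feeding this to `openCrossing_reroute` gives the surgery
`bypass_openCrossing` (REGISTERED): if the selector of `(t, d)` is on and the read-out with the
shared coin ON crosses `R` between two slabs, then the read-out with the shared coin OFF and the own
coins of the interior strip edges ON still crosses `R`.  (Aizenman–Grimmett, J. Stat. Phys. 63
(1991); Grimmett 1999 §3.3, essential enhancements.)
-/

noncomputable section

namespace Summit.CriticalPhenomena.CardyFormulaZ2.Theorems.CardySelfRefinement

open scoped Topology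
open Filter Set MeasureTheory
open Literature.Probability.LatticeModels Literature.Probability.Percolation
open Literature.Probability.Percolation.QuadCrossing
open Summit.CriticalPhenomena.CardyFormulaZ2.Theses.CardySelfRefinement

/-- The strip `N` of the bundle `(t, d)` (local notation, as in `…StubCornerHWBBypassWalk`). -/
local notation3 (prettyPrint := false) "inN(" k ", " t ", " d ", " v ")" =>
  (∀ j : Fin 2, (k : ℤ) * t j - 1 ≤ (v : Site 2) j ∧ (v : Site 2) j ≤ (k : ℤ) * t j + (if j = d then (k : ℤ) + 1 else 1))

/-- The interior (non-axial) edges of the strip, as a bond configuration (local notation). -/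
local notation3 (prettyPrint := false) "Ω(" k ", " t ", " d ")" =>
  {e : Sym2 (Site 2) | ∃ g : Site 2 × Fin 2, e = edgeOf g ∧ ¬ ax k g ∧ inN(k, t, d, g.1) ∧ inN(k, t, d, g.1 + dirVec g.2)}

/-- Box-closed vertex sets (local notation): with two points, `R` contains the lattice box they span. -/
local notation3 (prettyPrint := false) "BoxClosed(" R ")" =>
  (∀ u ∈ (R : Set (Site 2)), ∀ w ∈ R, ∀ v : Site 2, (∀ j : Fin 2, min (u j) (w j) ≤ v j ∧ v j ≤ max (u j) (w j)) → v ∈ R)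

/-! ### Connectivity of the good part of the strip -/

/-- **Leaving the coarse row.**  A good vertex of the strip in `R` is joined inside `R`, by interior
strip edges, to a strip vertex of `R` off the coarse row. -/
theorem strip_leave_row {k : ℕ} (hk : k = 2 ∨ k = 3) {t : Site 2} {d d' : Fin 2} (hd : d' ≠ d)
    {R : Set (Site 2)} (hR2 : ∀ v ∈ R, ∀ j : Fin 2, v + dirVec j ∈ R ∨ v - dirVec j ∈ R)
    {a : Site 2} (haN : inN(k, t, d, a)) (haR : a ∈ R) (hU : a ≠ fun j => (k : ℤ) * t j)
    (hU' : a ≠ fun j => (k : ℤ) * t j + if j = d then (k : ℤ) else 0) :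
    ∃ a₁ : Site 2, inN(k, t, d, a₁) ∧ a₁ ∈ R ∧ a₁ d' ≠ (k : ℤ) * t d' ∧
      Ω(k, t, d) ∈ openConnIn R a a₁ := by
  by_cases hrow : a d' = (k : ℤ) * t d'
  · have haN' := (inN_iff hd a).1 haN
    have hcol : ¬ (k : ℤ) ∣ a d := by
      intro hdvd
      rcases dvd_cases_along hk haN'.1.1 haN'.1.2 hdvd with h | h
      · exact hU ((site_eq_iff_of_ne hd).2 ⟨h, hrow⟩)
      · refine hU' ((site_eq_iff_of_ne hd).2 ⟨?_, ?_⟩)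
        · simp [h]
        · simp [hrow, hd]
    have hk1 : (1 : ℤ) ≤ k := by rcases hk with rfl | rfl <;> norm_num
    rcases hR2 a haR d' with h | h
    · have hN1 : inN(k, t, d, a + dirVec d') := by
        refine (inN_iff hd _).2 ⟨?_, ?_⟩
        · rw [add_dirVec_apply, if_neg hd.symm, add_zero]; exact haN'.1
        · rw [add_dirVec_apply, if_pos rfl]; constructor <;> linarith [haN'.2.1]
      refine ⟨a + dirVec d', hN1, h, ?_, strip_adj_step ?_ haN hN1 haR h⟩
      · rw [add_dirVec_apply, if_pos rfl, hrow]; linarith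
      · rwa [ax_iff_dvd hd.symm]
    · have hN1 : inN(k, t, d, a - dirVec d') := by
        refine (inN_iff hd _).2 ⟨?_, ?_⟩
        · rw [sub_dirVec_apply, if_neg hd.symm, sub_zero]; exact haN'.1
        · rw [sub_dirVec_apply, if_pos rfl]; constructor <;> linarith [haN'.2.2]
      have heq : a - dirVec d' + dirVec d' = a := sub_add_cancel a _
      refine ⟨a - dirVec d', hN1, h, ?_, ?_⟩
      · rw [sub_dirVec_apply, if_pos rfl, hrow]; linarith
      · have hst := strip_adj_step (k := k) (t := t) (d := d) (R := R) (v := a - dirVec d') (δ := d')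
          (by rw [ax_iff_dvd hd.symm, sub_dirVec_apply, if_neg hd.symm, sub_zero]; exact hcol) hN1
          (by rw [heq]; exact haN) h (by rw [heq]; exact haR)
        rw [heq] at hst
        exact ⟨hst.2.1, hst.1, hst.2.2.symm⟩
  · exact ⟨a, haN, haR, hrow, haR, haR, SimpleGraph.Reachable.refl _⟩

/-- **A good column.**  For two strip vertices of `R` off the coarse row there is a non-coarse
column of the strip met by `R`. -/
theorem strip_good_col {k : ℕ} (hk : k = 2 ∨ k = 3) {t : Site 2} {d d' : Fin 2} (hd : d' ≠ d)
    {R : Set (Site 2)} (hRc : BoxClosed(R))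
    (hR2 : ∀ v ∈ R, ∀ j : Fin 2, v + dirVec j ∈ R ∨ v - dirVec j ∈ R)
    {a b : Site 2} (haN : inN(k, t, d, a)) (haR : a ∈ R) (hbN : inN(k, t, d, b)) (hbR : b ∈ R) :
    ∃ x : ℤ, ¬ (k : ℤ) ∣ x ∧ (k : ℤ) * t d - 1 ≤ x ∧ x ≤ (k : ℤ) * t d + (k : ℤ) + 1 ∧
      ∃ u ∈ R, u d = x := by
  have haN' := (inN_iff hd a).1 haN
  have hbN' := (inN_iff hd b).1 hbN
  have hk1 : (1 : ℤ) ≤ k := by rcases hk with rfl | rfl <;> norm_num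
  by_cases h1 : (k : ℤ) ∣ a d
  · by_cases h2 : (k : ℤ) ∣ b d
    · have e1 := dvd_cases_along hk haN'.1.1 haN'.1.2 h1
      have e2 := dvd_cases_along hk hbN'.1.1 hbN'.1.2 h2
      by_cases h3 : a d = b d
      · rcases hR2 a haR d with h | h
        · refine ⟨a d + 1, (not_dvd_near hk h1).1, by linarith [haN'.1.1], ?_, a + dirVec d, h, ?_⟩
          · rcases e1 with e1 | e1 <;> linarith
          · rw [add_dirVec_apply, if_pos rfl]
        · refine ⟨a d - 1, (not_dvd_near hk h1).2, ?_, by linarith [haN'.1.2], a - dirVec d, h, ?_⟩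
          · rcases e1 with e1 | e1 <;> linarith
          · rw [sub_dirVec_apply, if_pos rfl]
      · refine ⟨(k : ℤ) * t d + 1, (not_dvd_near hk (dvd_mul_right _ _)).1, by linarith, by linarith,
          a + (((k : ℤ) * t d + 1) - a d) • dirVec d, ?_, ?_⟩
        · refine hRc a haR b hbR _ fun j => ?_
          rw [add_smul_dirVec_apply]
          rcases fin_two_cases_of_ne hd j with rfl | rfl
          · rw [if_pos rfl]
            rcases e1 with e1 | e1 <;> rcases e2 with e2 | e2
            · exact absurd (e1.trans e2.symm) h3
            · rw [e1, e2]; constructor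
              · exact min_le_of_left_le (by linarith)
              · exact le_max_of_le_right (by linarith)
            · rw [e1, e2]; constructor
              · exact min_le_of_right_le (by linarith)
              · exact le_max_of_le_left (by linarith)
            · exact absurd (e1.trans e2.symm) h3
          · rw [if_neg hd, add_zero]
            exact ⟨min_le_left _ _, le_max_left _ _⟩
        · rw [add_smul_dirVec_apply, if_pos rfl]; ring
    · exact ⟨b d, h2, hbN'.1.1, hbN'.1.2, b, hbR, rfl⟩
  · exact ⟨a d, h1, haN'.1.1, haN'.1.2, a, haR, rfl⟩

/-- **Joining two off-row strip vertices** of `R` inside `R` by interior strip edges: along the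
row to a good column, across (through the coarse row) on the good column, along the row. -/
theorem strip_connect_offrow {k : ℕ} (hk : k = 2 ∨ k = 3) {t : Site 2} {d d' : Fin 2} (hd : d' ≠ d)
    {R : Set (Site 2)} (hRc : BoxClosed(R))
    (hR2 : ∀ v ∈ R, ∀ j : Fin 2, v + dirVec j ∈ R ∨ v - dirVec j ∈ R)
    {a b : Site 2} (haN : inN(k, t, d, a)) (haR : a ∈ R) (ha : a d' ≠ (k : ℤ) * t d')
    (hbN : inN(k, t, d, b)) (hbR : b ∈ R) (hb : b d' ≠ (k : ℤ) * t d') :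
    Ω(k, t, d) ∈ openConnIn R a b := by
  have haN' := (inN_iff hd a).1 haN
  have hbN' := (inN_iff hd b).1 hbN
  obtain ⟨x, hx, hx1, hx2, u, huR, hux⟩ := strip_good_col hk hd hRc hR2 haN haR hbN hbR
  have hrowa : ¬ (k : ℤ) ∣ a d' := not_dvd_of_offrow hk haN'.2.1 haN'.2.2 ha
  have hrowb : ¬ (k : ℤ) ∣ b d' := not_dvd_of_offrow hk hbN'.2.1 hbN'.2.2 hb
  -- the points `P = (x, a_{d'})`, `Q = (x, b_{d'})` on the good column
  set P : Site 2 := a + (x - a d) • dirVec d with hP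
  set Q : Site 2 := b + (x - b d) • dirVec d with hQ
  have hPd : P d = x := by rw [hP, add_smul_dirVec_apply, if_pos rfl]; ring
  have hPd' : P d' = a d' := by rw [hP, add_smul_dirVec_apply, if_neg hd, add_zero]
  have hQd : Q d = x := by rw [hQ, add_smul_dirVec_apply, if_pos rfl]; ring
  have hQd' : Q d' = b d' := by rw [hQ, add_smul_dirVec_apply, if_neg hd, add_zero]
  have hPN : inN(k, t, d, P) := (inN_iff hd P).2 ⟨by rw [hPd]; exact ⟨hx1, hx2⟩, by rw [hPd']; exact haN'.2⟩
  have hQN : inN(k, t, d, Q) := (inN_iff hd Q).2 ⟨by rw [hQd]; exact ⟨hx1, hx2⟩, by rw [hQd']; exact hbN'.2⟩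
  have hbetw : ∀ (c : Site 2) (Pt : Site 2), Pt d = x → Pt d' = c d' →
      ∀ j : Fin 2, min (u j) (c j) ≤ Pt j ∧ Pt j ≤ max (u j) (c j) := by
    intro c Pt h1 h2 j
    rcases fin_two_cases_of_ne hd j with rfl | rfl
    · rw [h1, ← hux]; exact ⟨min_le_left _ _, le_max_left _ _⟩
    · rw [h2]; exact ⟨min_le_right _ _, le_max_right _ _⟩
  have hPR : P ∈ R := hRc u huR a haR P (hbetw a P hPd hPd')
  have hQR : Q ∈ R := hRc u huR b hbR Q (hbetw b Q hQd hQd')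
  have haP : Ω(k, t, d) ∈ openConnIn R a P := strip_run hRc hd (x - a d) a hrowa haN haR hPN hPR
  have hbQ : Ω(k, t, d) ∈ openConnIn R b Q := strip_run hRc hd (x - b d) b hrowb hbN hbR hQN hQR
  have hQeq : Q = P + (b d' - a d') • dirVec d' := by
    refine (site_eq_iff_of_ne hd).2 ⟨?_, ?_⟩
    · rw [add_smul_dirVec_apply, if_neg hd.symm, add_zero, hQd, hPd]
    · rw [add_smul_dirVec_apply, if_pos rfl, hQd', hPd']; ring
  have hPQ : Ω(k, t, d) ∈ openConnIn R P Q := by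
    rw [hQeq]
    refine strip_run hRc hd.symm (b d' - a d') P (by rw [hPd]; exact hx) hPN hPR ?_ ?_
    · rw [← hQeq]; exact hQN
    · rw [← hQeq]; exact hQR
  exact GM.openConnIn_trans haP (GM.openConnIn_trans hPQ ⟨hbQ.2.1, hbQ.1, hbQ.2.2.symm⟩)

/-- **The good part of the strip is connected inside `R`.**  Any two strip vertices of `R` other
than the two corners `kt`, `kt + k e_d` of the bundle are joined inside `R` by interior strip
edges (for a box-closed `R` with the two-neighbour property). -/
theorem strip_connected {k : ℕ} (hk : k = 2 ∨ k = 3) {t : Site 2} {d d' : Fin 2} (hd : d' ≠ d)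
    {R : Set (Site 2)} (hRc : BoxClosed(R))
    (hR2 : ∀ v ∈ R, ∀ j : Fin 2, v + dirVec j ∈ R ∨ v - dirVec j ∈ R)
    {a b : Site 2} (haN : inN(k, t, d, a)) (haR : a ∈ R) (haU : a ≠ fun j => (k : ℤ) * t j)
    (haU' : a ≠ fun j => (k : ℤ) * t j + if j = d then (k : ℤ) else 0)
    (hbN : inN(k, t, d, b)) (hbR : b ∈ R) (hbU : b ≠ fun j => (k : ℤ) * t j)
    (hbU' : b ≠ fun j => (k : ℤ) * t j + if j = d then (k : ℤ) else 0) :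
    Ω(k, t, d) ∈ openConnIn R a b := by
  obtain ⟨a₁, ha₁N, ha₁R, ha₁, haa₁⟩ := strip_leave_row hk hd hR2 haN haR haU haU'
  obtain ⟨b₁, hb₁N, hb₁R, hb₁, hbb₁⟩ := strip_leave_row hk hd hR2 hbN hbR hbU hbU'
  exact GM.openConnIn_trans haa₁ (GM.openConnIn_trans
    (strip_connect_offrow hk hd hRc hR2 ha₁N ha₁R ha₁ hb₁N hb₁R hb₁) ⟨hbb₁.2.1, hbb₁.1, hbb₁.2.2.symm⟩)

/-! ### The two corners of the bundle -/

/-- **Unit steps from a corner stay in the good part of the strip** (`k ≥ 2`). -/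
theorem bundle_corner_step {k : ℕ} (hk : k = 2 ∨ k = 3) {t : Site 2} {d : Fin 2} {x y : Site 2} (e : Fin 2)
    (hx : x = (fun j => (k : ℤ) * t j) ∨ x = fun j => (k : ℤ) * t j + if j = d then (k : ℤ) else 0)
    (hy : y = x + dirVec e ∨ x = y + dirVec e) :
    inN(k, t, d, y) ∧ y ≠ (fun j => (k : ℤ) * t j) ∧
      y ≠ fun j => (k : ℤ) * t j + if j = d then (k : ℤ) else 0 := by
  have hk2 : (2 : ℤ) ≤ k := by rcases hk with rfl | rfl <;> norm_num
  have hyx : ∀ j, y j = x j + (if j = e then 1 else 0) ∨ y j = x j - (if j = e then 1 else 0) := by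
    intro j
    rcases hy with rfl | rfl
    · exact Or.inl (add_dirVec_apply x e j)
    · right; rw [add_dirVec_apply]; ring
  have hxj : ∀ j, x j = (k : ℤ) * t j ∨ x j = (k : ℤ) * t j + if j = d then (k : ℤ) else 0 := by
    intro j
    rcases hx with rfl | rfl
    · exact Or.inl rfl
    · exact Or.inr rfl
  refine ⟨fun j => ?_, fun h => ?_, fun h => ?_⟩
  · rcases hyx j with h | h <;> rcases hxj j with h' | h' <;> rw [h, h'] <;> split_ifs <;>
      constructor <;> linarith
  · have h1 : y e = (k : ℤ) * t e := congrFun h e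
    have h2 := hyx e
    have h3 := hxj e
    rw [if_pos rfl] at h2
    rcases h2 with h2 | h2 <;> rcases h3 with h3 | h3 <;> (try split_ifs at h3) <;> linarith
  · have h1 : y e = (k : ℤ) * t e + if e = d then (k : ℤ) else 0 := congrFun h e
    have h2 := hyx e
    have h3 := hxj e
    rw [if_pos rfl] at h2
    rcases h2 with h2 | h2 <;> rcases h3 with h3 | h3 <;> (try split_ifs at h1 h3) <;> linarith

/-- The vertices of the bundle `(t, d)` (local notation): `kt + i e_d`, `0 ≤ i ≤ k`. -/
local notation3 (prettyPrint := false) "inD(" k ", " t ", " d ", " d' ", " v ")" =>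
  ((v : Site 2) d' = (k : ℤ) * t d' ∧ (k : ℤ) * t d ≤ (v : Site 2) d ∧ (v : Site 2) d ≤ (k : ℤ) * t d + k)

/-- Bundle vertices lie in the strip. -/
theorem inN_of_inD {k : ℕ} {t : Site 2} {d d' : Fin 2} (hd : d' ≠ d) {v : Site 2}
    (hv : inD(k, t, d, d', v)) : inN(k, t, d, v) :=
  (inN_iff hd v).2 ⟨⟨by linarith [hv.2.1], by linarith [hv.2.2]⟩, by rw [hv.1]; constructor <;> linarith⟩

/-- A bundle vertex outside the good part of the strip is a corner. -/
theorem corner_of_inD {k : ℕ} {t : Site 2} {d d' : Fin 2} (hd : d' ≠ d) {v : Site 2}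
    (hv : inD(k, t, d, d', v))
    (hC : ¬ (inN(k, t, d, v) ∧ v ≠ (fun j => (k : ℤ) * t j) ∧
      v ≠ fun j => (k : ℤ) * t j + if j = d then (k : ℤ) else 0)) :
    v = (fun j => (k : ℤ) * t j) ∨ v = fun j => (k : ℤ) * t j + if j = d then (k : ℤ) else 0 := by
  by_contra h
  exact hC ⟨inN_of_inD hd hv, fun h1 => h (Or.inl h1), fun h2 => h (Or.inr h2)⟩

/-- The endpoints of a sub-edge of the bundle `(t, d)` are bundle vertices (`k = 2, 3`). -/
theorem inD_of_subedge {k : ℕ} (hk : k = 2 ∨ k = 3) {t : Site 2} {d d' : Fin 2} (hd : d' ≠ d)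
    {v : Site 2} (h : ax k (v, d) ∧ tb k (v, d) = t) :
    inD(k, t, d, d', v) ∧ inD(k, t, d, d', v + dirVec d) := by
  obtain ⟨hax, htb⟩ := h
  rw [ax_iff_dvd hd] at hax
  have h1 : v d' / (k : ℤ) = t d' := congrFun htb d'
  have h2 : v d / (k : ℤ) = t d := congrFun htb d
  rw [add_dirVec_apply, add_dirVec_apply, if_pos rfl, if_neg hd, add_zero]
  rcases hk with rfl | rfl <;> push_cast at * <;> omega

/-- The other index of `Fin 2` differs. -/
theorem acr_ne (d : Fin 2) : (if d = 0 then (1 : Fin 2) else 0) ≠ d := by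
  revert d; decide

/-! ## The bypass surgery -/

/-- **The interior-bypass surgery (deterministic part of brick (ii-c) of stub
`stub_cornerHardWayBoxes`).**  Let `k = 2, 3`, `(t, d)` a bundle whose selector is on in the coin
sample `S`, `R` a box-closed vertex set with the two-neighbour property, `A`, `B` slabs across
the direction `j₁`.  If the read-out of `S` with the shared coin of `(t, d)` ON crosses `R` from
`A` to `B`, then so does the read-out of `S` with the shared coin OFF and the own coins `By` on,
as soon as `By` (own coins only) contains the own coin of every interior edge of the strip
`[kt_d - 1, kt_d + k + 1] × [kt_{d'} - 1, kt_{d'} + 1]` of the bundle. -/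
theorem bypass_openCrossing : ∀ k : ℕ, k = 2 ∨ k = 3 → ∀ (t : Site 2) (d : Fin 2) (S By : Set (Site 2 × Fin 2 × Fin 3)), (t, d, (2 : Fin 3)) ∈ S → (∀ i ∈ By, i.2.2 = 0) → (∀ g : Site 2 × Fin 2, ¬ ax k g → (∀ j : Fin 2, (k : ℤ) * t j - 1 ≤ g.1 j ∧ g.1 j ≤ (k : ℤ) * t j + (if j = d then (k : ℤ) + 1 else 1)) → (∀ j : Fin 2, (k : ℤ) * t j - 1 ≤ (g.1 + dirVec g.2) j ∧ (g.1 + dirVec g.2) j ≤ (k : ℤ) * t j + (if j = d then (k : ℤ) + 1 else 1)) → (g.1, g.2, (0 : Fin 3)) ∈ By) → ∀ (R A B : Set (Site 2)) (j₁ : Fin 2), (∀ u ∈ R, ∀ w ∈ R, ∀ v : Site 2, (∀ j : Fin 2, min (u j) (w j) ≤ v j ∧ v j ≤ max (u j) (w j)) → v ∈ R) → (∀ v ∈ R, ∀ j : Fin 2, v + dirVec j ∈ R ∨ v - dirVec j ∈ R) → (∀ v ∈ A, v + dirVec j₁ ∈ A ∧ v - dirVec j₁ ∈ A) → (∀ v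 ∈ B, v + dirVec j₁ ∈ B ∧ v - dirVec j₁ ∈ B) → cfg k (insert (t, d, (1 : Fin 3)) S) ∈ openCrossing R A B → cfg k (S \ {(t, d, (1 : Fin 3))} ∪ By) ∈ openCrossing R A B := by
  intro k hk t d S By hsel hBy0 hBy R A B j₁ hRc hR2 hA hB hω
  -- the other index
  set d' : Fin 2 := if d = 0 then 1 else 0 with hd'
  have hd : d' ≠ d := acr_ne d
  -- corners, danger zone, good set
  set U : Site 2 := fun j => (k : ℤ) * t j with hU
  set U' : Site 2 := fun j => (k : ℤ) * t j + if j = d then (k : ℤ) else 0 with hU'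
  set D : Set (Site 2) := {v | inD(k, t, d, d', v)} with hD
  set C : Set (Site 2) := {v | inN(k, t, d, v) ∧ v ≠ U ∧ v ≠ U'} with hC
  have hstep : ∀ x y : Site 2, (x = U ∨ x = U') → ∀ e : Fin 2, (y = x + dirVec e ∨ x = y + dirVec e) →
      y ∈ C := fun x y hx e hy => bundle_corner_step hk e hx hy
  refine openCrossing_reroute (D := D) (C := C) (ω' := cfg k (S \ {(t, d, (1 : Fin 3))})) hω
    ?_ ?_ ?_ ?_ ?_ ?_
  · -- edges off the bundle survive closing the shared coin
    intro x y he hxy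
    refine mem_cfg_sdiff_shared k t d S he ?_
    rintro ⟨v, hv, hxy'⟩
    have hvD := inD_of_subedge hk hd hv
    rcases Sym2.eq_iff.1 hxy' with ⟨rfl, rfl⟩ | ⟨rfl, rfl⟩
    · exact hxy.elim (fun h => h hvD.1) (fun h => h hvD.2)
    · exact hxy.elim (fun h => h hvD.2) (fun h => h hvD.1)
  · -- neighbours of corners are good
    intro x hxD hxC y he hne
    obtain ⟨e, hy⟩ := exists_dirVec_of_mem_cfg k he
    exact hstep x y (corner_of_inD hd hxD hxC) e hy
  · -- good vertices of `R` are joined by the opened bypass edges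
    rintro a ⟨⟨haN, haU, haU'⟩, haR⟩ b ⟨⟨hbN, hbU, hbU'⟩, hbR⟩
    have hsub : Ω(k, t, d) ⊆ cfg k (S \ {(t, d, (1 : Fin 3))} ∪ By) := by
      rintro e ⟨g, rfl, hax, hg1, hg2⟩
      exact edgeOf_mem_cfg_of_not_ax k hax (Or.inr (hBy g hax hg1 hg2))
    exact isUpperSet_openConnIn R a b hsub (strip_connected hk hd hRc hR2 haN haR haU haU' hbN hbR hbU hbU')
  · -- opening own coins only opens edges
    refine cfg_mono_of_own k Set.subset_union_left fun x hx hx0 => ?_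
    exact hx.elim id fun h => absurd (hBy0 x h) hx0
  · -- a corner in `A` has a good substitute in `A`
    rintro x ⟨hxD, hxR⟩ hxA hxC
    have hx := corner_of_inD hd hxD hxC
    rcases hR2 x hxR j₁ with h | h
    · exact ⟨x + dirVec j₁, ⟨hstep x _ hx j₁ (Or.inl rfl), h⟩, (hA x hxA).1⟩
    · exact ⟨x - dirVec j₁, ⟨hstep x _ hx j₁ (Or.inr (sub_add_cancel x _).symm), h⟩, (hA x hxA).2⟩
  · rintro x ⟨hxD, hxR⟩ hxB hxC
    have hx := corner_of_inD hd hxD hxC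
    rcases hR2 x hxR j₁ with h | h
    · exact ⟨x + dirVec j₁, ⟨hstep x _ hx j₁ (Or.inl rfl), h⟩, (hB x hxB).1⟩
    · exact ⟨x - dirVec j₁, ⟨hstep x _ hx j₁ (Or.inr (sub_add_cancel x _).symm), h⟩, (hB x hxB).2⟩

end Summit.CriticalPhenomena.CardyFormulaZ2.Theorems.CardySelfRefinement

end
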